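import Mathlib

/-!
# Uniform convergence of twisted difference maps (step T2c)

Crux `WitnessCharge` (stmt-SmoothPoincare4-7824), route `SullivanDual`, line Sketch. For a map
`h : ℂ → F` into a real normed space carrying a field of operators `J`, the twisted difference
map is
`T (z, w) = (‖z - w‖ ^ 2)⁻¹ • (Re (z - w) • (h z - h w) - Im (z - w) • J (h w) (h z - h w))`
off the diagonal and `dh_w 1` on it. This file shows: if `hs n → h` and `d(hs n) → dh`
uniformly on a compact convex set `S` (all maps `C¹` on an open set `U ⊇ S`, `J` continuous on
an open set `O ⊇ h '' S`), then the twisted difference maps `Ts n` of `hs n` converge to `T`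
uniformly on `S ×ˢ S`. No `J`-holomorphicity is needed.

Proof. On the diagonal `Ts n (w, w) - T (w, w) = (d(hs n)_w - dh_w) 1`. Off the diagonal, with
`u := z - w`, `Δ := h z - h w`, `Δₙ := hs n z - hs n w`, `J₀ := J (h w)`, `Jₙ := J (hs n w)`,
`Ts n (z, w) - T (z, w) = (‖u‖ ^ 2)⁻¹ • (Re u • (Δₙ - Δ) - Im u • (Jₙ (Δₙ - Δ) + (Jₙ - J₀) Δ))`.
The mean value inequality on the convex set `S` gives `‖Δ‖ ≤ L ‖u‖` (`L` a bound for `‖dh‖` on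
the compact `S`) and `‖Δₙ - Δ‖ ≤ a ‖u‖` once `‖d(hs n) - dh‖ ≤ a` on `S`; hence
`‖Ts n (z, w) - T (z, w)‖ ≤ a (1 + ‖Jₙ‖) + ‖Jₙ - J₀‖ L`. Finally `J` is bounded and uniformly
continuous on a compact closed thickening `K₁ ⊆ O` of `h '' S` (finite dimension), and for `n`
large `hs n w ∈ K₁` is uniformly close to `h w`, so `‖Jₙ‖` is uniformly bounded and
`‖Jₙ - J₀‖` uniformly small.

Mathlib only; no definitions, no `sorry`.
-/

noncomputable section

-- the summit path `SmoothPoincare4/SmoothPoincare4` forces a duplicated namespace segment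
set_option linter.dupNamespace false

open Set Filter Metric Function Topology

namespace Summit.SmoothPoincare4.SmoothPoincare4.Theorems.WitnessCharge.PencilIncompleteness

/-- Algebraic identity: the difference of two twisted difference quotients (built from `Δ₁, J₁`
and from `Δ, J₀`, with the same scalar weights) is the twisted combination of `Δ₁ - Δ` and
`J₁ (Δ₁ - Δ) + (J₁ - J₀) Δ`. -/
theorem helper_tdiff_tendstoUniformlyOn_identity
    {F : Type*} [NormedAddCommGroup F] [NormedSpace ℝ F] (J₀ J₁ : F →L[ℝ] F) (c a b : ℝ)
    (Δ Δ₁ : F) :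
    c • (a • Δ₁ - b • J₁ Δ₁) - c • (a • Δ - b • J₀ Δ) =
      c • (a • (Δ₁ - Δ) - b • (J₁ (Δ₁ - Δ) + (J₁ - J₀) Δ)) := by
  rw [map_sub, sub_apply]
  module

/-- Norm bound: if `‖E₁‖ ≤ C₁ ‖u‖`, `‖E₂‖ ≤ C₂ ‖u‖` and `u ≠ 0`, then the twisted combination
`(‖u‖ ^ 2)⁻¹ • (Re u • E₁ - Im u • E₂)` has norm at most `C₁ + C₂`. -/
theorem helper_tdiff_tendstoUniformlyOn_bound
    {F : Type*} [NormedAddCommGroup F] [NormedSpace ℝ F] (u : ℂ) (E₁ E₂ : F) (C₁ C₂ : ℝ)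
    (hu : u ≠ 0) (h₁ : ‖E₁‖ ≤ C₁ * ‖u‖) (h₂ : ‖E₂‖ ≤ C₂ * ‖u‖) :
    ‖(‖u‖ ^ 2)⁻¹ • (u.re • E₁ - u.im • E₂)‖ ≤ C₁ + C₂ := by
  have hu' : 0 < ‖u‖ := norm_pos_iff.mpr hu
  have hN : 0 < ‖u‖ ^ 2 := by positivity
  rw [norm_smul, norm_inv, norm_pow, norm_norm, inv_mul_le_iff₀ hN]
  calc ‖u.re • E₁ - u.im • E₂‖ ≤ ‖u.re • E₁‖ + ‖u.im • E₂‖ := norm_sub_le _ _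
    _ = |u.re| * ‖E₁‖ + |u.im| * ‖E₂‖ := by
        rw [norm_smul, norm_smul, Real.norm_eq_abs, Real.norm_eq_abs]
    _ ≤ ‖u‖ * (C₁ * ‖u‖) + ‖u‖ * (C₂ * ‖u‖) :=
        add_le_add (mul_le_mul (Complex.abs_re_le_norm u) h₁ (norm_nonneg _) (norm_nonneg _))
          (mul_le_mul (Complex.abs_im_le_norm u) h₂ (norm_nonneg _) (norm_nonneg _))
    _ = ‖u‖ ^ 2 * (C₁ + C₂) := by ring

/-- **T2c — uniform convergence of twisted difference maps on `S ×ˢ S`.**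
If `hs n → h` and `fderiv ℝ (hs n) → fderiv ℝ h` uniformly on a compact convex set `S` (all
maps `C¹` on an open set `U ⊇ S`, the operator field `J` continuous on an open set `O ⊇ h '' S`),
then the twisted difference maps `Ts n` of `hs n` converge to the twisted difference map `T` of
`h` uniformly on `S ×ˢ S`. -/
theorem helper_tdiff_tendstoUniformlyOn :
    ∀ (F : Type) [NormedAddCommGroup F] [NormedSpace ℝ F] [FiniteDimensional ℝ F]
      (J : F → F →L[ℝ] F) (O : Set F) (h : ℂ → F) (hs : ℕ → ℂ → F) (U S : Set ℂ)
      (T : ℂ × ℂ → F) (Ts : ℕ → ℂ × ℂ → F),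
      IsOpen O → ContinuousOn J O → IsOpen U → IsCompact S → Convex ℝ S → S ⊆ U →
      ContDiffOn ℝ 1 h U → (∀ n, ContDiffOn ℝ 1 (hs n) U) → Set.MapsTo h S O →
      TendstoUniformlyOn hs h atTop S →
      TendstoUniformlyOn (fun n => fderiv ℝ (hs n)) (fderiv ℝ h) atTop S →
      (∀ z w : ℂ, T (z, w) = if z = w then fderiv ℝ h w 1 else
        (‖z - w‖ ^ 2)⁻¹ • ((z - w).re • (h z - h w) - (z - w).im • J (h w) (h z - h w))) →
      (∀ n, ∀ z w : ℂ, Ts n (z, w) = if z = w then fderiv ℝ (hs n) w 1 else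
        (‖z - w‖ ^ 2)⁻¹ •
          ((z - w).re • (hs n z - hs n w) - (z - w).im • J (hs n w) (hs n z - hs n w))) →
      TendstoUniformlyOn Ts T atTop (S ×ˢ S) := by
  intro F _ _ _ J O h hs U S T Ts hO hJ hU hS hSc hSU hh hhs hhO hcv hcv' hT hTs
  -- basic regularity of `h` and `hs n` on `S`
  have hcont : ContinuousOn h S := hh.continuousOn.mono hSU
  have hdiff : ∀ x ∈ S, DifferentiableAt ℝ h x := fun x hx =>
    (hh.differentiableOn one_ne_zero).differentiableAt (hU.mem_nhds (hSU hx))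
  have hdiffs : ∀ n, ∀ x ∈ S, DifferentiableAt ℝ (hs n) x := fun n x hx =>
    ((hhs n).differentiableOn one_ne_zero).differentiableAt (hU.mem_nhds (hSU hx))
  have hfd : ContinuousOn (fderiv ℝ h) S :=
    (hh.continuousOn_fderiv_of_isOpen hU le_rfl).mono hSU
  -- a bound `L ≥ 0` for `‖dh‖` on the compact set `S`
  obtain ⟨L, hL, hL0⟩ : ∃ L : ℝ, (∀ x ∈ S, ‖fderiv ℝ h x‖ ≤ L) ∧ 0 ≤ L := by
    obtain ⟨L₀, hL₀⟩ := hS.exists_bound_of_continuousOn hfd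
    exact ⟨max L₀ 0, fun x hx => (hL₀ x hx).trans (le_max_left _ _), le_max_right _ _⟩
  -- a compact closed thickening `K₁ := cthickening δ (h '' S)` inside `O`
  have hKc : IsCompact (h '' S) := hS.image_of_continuousOn hcont
  obtain ⟨δ, hδ, hδO⟩ := hKc.exists_cthickening_subset_open hO hhO.image_subset
  have hK₁ : IsCompact (cthickening δ (h '' S)) := hKc.cthickening
  have hJK : ContinuousOn J (cthickening δ (h '' S)) := hJ.mono hδO
  -- a bound `M ≥ 0` for `‖J‖` on `K₁`, and uniform continuity of `J` on `K₁`
  obtain ⟨M, hM, hM0⟩ : ∃ M : ℝ, (∀ y ∈ cthickening δ (h '' S), ‖J y‖ ≤ M) ∧ 0 ≤ M := by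
    obtain ⟨M₀, hM₀⟩ := hK₁.exists_bound_of_continuousOn hJK
    exact ⟨max M₀ 0, fun y hy => (hM₀ y hy).trans (le_max_left _ _), le_max_right _ _⟩
  have hJu : UniformContinuousOn J (cthickening δ (h '' S)) :=
    hK₁.uniformContinuousOn_of_continuous hJK
  rw [Metric.tendstoUniformlyOn_iff] at hcv hcv' ⊢
  intro ε hε
  -- tolerances: `ε₁` for the variation of `J`, `a` for `‖d(hs n) - dh‖`
  set ε₁ : ℝ := ε / (3 * (L + 1)) with hε₁_def
  have hε₁ : 0 < ε₁ := by positivity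
  have hε₁' : ε₁ * (L + 1) = ε / 3 := by
    rw [hε₁_def]; field_simp
  set a : ℝ := ε / (3 * (M + 2)) with ha_def
  have ha : 0 < a := by positivity
  have ha' : a * (M + 2) = ε / 3 := by
    rw [ha_def]; field_simp
  obtain ⟨η, hη, hJη⟩ := Metric.uniformContinuousOn_iff.mp hJu ε₁ hε₁
  filter_upwards [hcv (min δ η) (lt_min hδ hη), hcv' a ha] with n hn hn'
  -- `‖d(hs n) - dh‖ < a` on `S`
  have hd' : ∀ x ∈ S, ‖fderiv ℝ (hs n) x - fderiv ℝ h x‖ < a := fun x hx => by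
    rw [← dist_eq_norm, dist_comm]; exact hn' x hx
  rintro ⟨z, w⟩ hzw
  obtain ⟨hz, hw⟩ := Set.mem_prod.mp hzw
  rw [dist_comm, dist_eq_norm]
  by_cases hzw' : z = w
  · -- on the diagonal
    rw [hTs n z w, hT z w, if_pos hzw', if_pos hzw']
    calc ‖fderiv ℝ (hs n) w 1 - fderiv ℝ h w 1‖ = ‖(fderiv ℝ (hs n) w - fderiv ℝ h w) 1‖ := rfl
      _ ≤ ‖fderiv ℝ (hs n) w - fderiv ℝ h w‖ * ‖(1 : ℂ)‖ := ContinuousLinearMap.le_opNorm _ _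
      _ < a := by rw [norm_one, mul_one]; exact hd' w hw
      _ ≤ ε := by nlinarith [mul_nonneg ha.le hM0]
  · -- off the diagonal
    rw [hTs n z w, hT z w, if_neg hzw', if_neg hzw']
    -- `hs n w` and `h w` lie in `K₁` and are `η`-close
    have hnw : dist (h w) (hs n w) < min δ η := hn w hw
    have hmem₁ : hs n w ∈ cthickening δ (h '' S) :=
      mem_cthickening_of_dist_le (hs n w) (h w) δ (h '' S) (mem_image_of_mem h hw)
        (by rw [dist_comm]; exact ((lt_min_iff.mp hnw).1).le)
    have hmem₀ : h w ∈ cthickening δ (h '' S) :=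
      self_subset_cthickening _ (mem_image_of_mem h hw)
    have hJd : ‖J (hs n w) - J (h w)‖ ≤ ε₁ := by
      rw [← dist_eq_norm]
      exact (hJη (hs n w) hmem₁ (h w) hmem₀
        (by rw [dist_comm]; exact (lt_min_iff.mp hnw).2)).le
    have hJb : ‖J (hs n w)‖ ≤ M := hM _ hmem₁
    -- mean value inequalities on the convex set `S`
    have hΔ : ‖h z - h w‖ ≤ L * ‖z - w‖ :=
      hSc.norm_image_sub_le_of_norm_fderiv_le hdiff hL hw hz
    have hΔd : ‖(hs n z - hs n w) - (h z - h w)‖ ≤ a * ‖z - w‖ := by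
      have hmvt := hSc.norm_image_sub_le_of_norm_hasFDerivWithin_le
        (f := fun x => hs n x - h x) (f' := fun x => fderiv ℝ (hs n) x - fderiv ℝ h x)
        (fun x hx =>
          ((hdiffs n x hx).hasFDerivAt.sub (hdiff x hx).hasFDerivAt).hasFDerivWithinAt)
        (fun x hx => (hd' x hx).le) hw hz
      calc ‖(hs n z - hs n w) - (h z - h w)‖ = ‖(hs n z - h z) - (hs n w - h w)‖ := by
            congr 1; abel
        _ ≤ a * ‖z - w‖ := hmvt
    -- the second slot of the twisted combination
    have hE₂ : ‖J (hs n w) ((hs n z - hs n w) - (h z - h w)) + (J (hs n w) - J (h w)) (h z - h w)‖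
        ≤ (M * a + ε₁ * L) * ‖z - w‖ := by
      calc ‖J (hs n w) ((hs n z - hs n w) - (h z - h w)) + (J (hs n w) - J (h w)) (h z - h w)‖
          ≤ ‖J (hs n w) ((hs n z - hs n w) - (h z - h w))‖
              + ‖(J (hs n w) - J (h w)) (h z - h w)‖ := norm_add_le _ _
        _ ≤ ‖J (hs n w)‖ * ‖(hs n z - hs n w) - (h z - h w)‖
              + ‖J (hs n w) - J (h w)‖ * ‖h z - h w‖ :=
            add_le_add (ContinuousLinearMap.le_opNorm _ _) (ContinuousLinearMap.le_opNorm _ _)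
        _ ≤ M * (a * ‖z - w‖) + ε₁ * (L * ‖z - w‖) :=
            add_le_add (mul_le_mul hJb hΔd (norm_nonneg _) hM0)
              (mul_le_mul hJd hΔ (norm_nonneg _) hε₁.le)
        _ = (M * a + ε₁ * L) * ‖z - w‖ := by ring
    rw [helper_tdiff_tendstoUniformlyOn_identity (J (h w)) (J (hs n w)) ((‖z - w‖ ^ 2)⁻¹)
      (z - w).re (z - w).im (h z - h w) (hs n z - hs n w)]
    calc ‖(‖z - w‖ ^ 2)⁻¹ • ((z - w).re • ((hs n z - hs n w) - (h z - h w)) - (z - w).im •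
            (J (hs n w) ((hs n z - hs n w) - (h z - h w)) + (J (hs n w) - J (h w)) (h z - h w)))‖
        ≤ a + (M * a + ε₁ * L) :=
          helper_tdiff_tendstoUniformlyOn_bound (z - w) _ _ a (M * a + ε₁ * L)
            (sub_ne_zero.mpr hzw') hΔd hE₂
      _ = a * (M + 1) + ε₁ * L := by ring
      _ < ε := by nlinarith

end Summit.SmoothPoincare4.SmoothPoincare4.Theorems.WitnessCharge.PencilIncompleteness
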